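import Literature.NumberTheory.EllipticCurves.HeegnerStabilizedModuleCyclicProofs
import Literature.NumberTheory.EllipticCurves.HeegnerEnvelopeCoherentPairPrincipalProofs
import HarnessLib

/-!
# The engine's coherent pair `(C₀, F₀)` WITH ITS `Λ`-ADIC STABILISED CLASS `κ_∞`: envelope, principal system,
# exact projections `proj_k κ_∞ = δ(κ_k)` and the cyclicity `Λκ_∞(C₀) = Λ ∙ κ_∞` in ONE `∃` (proofs file)

Topic `NumberTheory/EllipticCurves`. THEOREMS ONLY (no definition, no named fact, no `sorry`, no instance). A
re-run of the cell `bsd-print-x9`'s envelope engine (`exists_coherent_pair_envelope_principal`, seat x9-p1-w2 g4;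
`exists_coherent_pair_envelope`, seat x9-p2) that keeps two more outputs the engine can now produce: the class
`κ_∞ ∈ 𝔖` whose projection to every layer `k > δ` IS CGLS's level class `δ(κ_k)` (`stabilizedClassLayer C k`;
`exists_proj_mem_stabilizedClassLayer_of_coherent` under the shift law `d(k+1) = d(k) + n_k + 1`, which the engine's
jumps `n_j := d(j+1) − 1 − d(j)` satisfy), and the cyclicity `stabilizedHeegnerModule D C = Λ ∙ κ_∞`
(`stabilizedHeegnerModule_eq_span_singleton`). Written by seat `bsd-line-x9-p2` (g2) for the shared μ-item of the
cruxes stmt-BirchSwinnertonDyer-27077 / 27275: at the coherent pair `(C₀, F₀)` of the L∃ letter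
(`HeegnerMuPartStabilized.MuPartStabilizedCoherentPair` / shell `SpecWitnessesCoherentPair`) the port's
`SpecWitness.map_le` holds with `κ₁ := f κ_∞`, and the printed identification «`κ_∞` and `κ₁^{Hg}` generate the
same `Λ`-submodule» (CGLS Rem. 4.1.4) is to be cited for the ELEMENT `κ_∞ = lim←_k κ_k` exactly as printed.

WHAT. `exists_coherent_pair_envelope_principal_class`: under the engine's hypotheses (`K` imaginary quadratic with
(Heeg) for `N = N_E`, `4N ∣ β² − d_K`, `Dt`, `p ∤ N` good ORDINARY, `κ` with `K_k ⊆ K[p^{k+1}]` and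
`#Gal(K[p]/K[1]) = p − 1`, `γ` a topological generator, `E(K)[p] = 0`, a `Λ`-adic Selmer datum `D`):
`∃ C F x A`, both on `(Dt, β)`, with the principal-system identities, `ℋ_∞(F) ≤ Λκ_∞(C)`, `g • Λκ_∞(C) ≤ ℋ_∞(F)`
for some `g ≠ 0`, AND `∃ κ_∞ ∈ 𝔖` with `proj_k κ_∞ ∈ stabilizedClassLayer C k` for all `k > δ` and
`Λκ_∞(C) = Λ ∙ κ_∞`; `exists_coherent_pair_envelope_class` (the same without `x`, `A`).
HONEST FRAMING: assembly of landed theorems; the proof is the engine's proof plus two outputs; nothing about any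
particular curve; «beyond-print theorem»: no; BSD is not proved by any of this.

References: [CastellaGrossiLeeSkinner2022] Thm. 4.1.1 proof and Rem. 4.1.4 (arXiv:2008.02571v2 TeX L2213–2294);
[Howard2004HeegnerKolyvagin] §3.3, Thm. 3.3.7; [PerrinRiou1987BSMF] §3.3–3.4; [Cox2013] Thm. 7.24.
-/

set_option autoImplicit false

noncomputable section

open scoped Classical Pointwise

open WeierstrassCurve Literature.NumberTheory.EllipticCurves
  Literature.NumberTheory.EllipticCurves.CastellaGrossiLeeSkinner2022 ModularForms RingClassField PowerSeries

namespace Literature.NumberTheory.EllipticCurves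

section Envelope

variable {K : Type} [Field K] [NumberField K] {W : WeierstrassCurve ℚ} [W.IsElliptic] [W.IsGloballyMinimal]
  [NeZero (W.conductorNorm ℤ)] {p : ℕ} [Fact p.Prime]

/-- **The coherent pair with its principal system AND its `Λ`-adic stabilised class.** Same hypotheses and same
construction as `exists_coherent_pair_envelope_principal`; the `∃` additionally returns `κ_∞ ∈ 𝔖` with
`proj_k κ_∞ ∈ stabilizedClassLayer C k` (`= δ(κ_k)`) for every `k > δ` (the engine's jumps satisfy the shift law
`d(k+1) = d(k) + n_k + 1`) and `stabilizedHeegnerModule D C = Λ ∙ κ_∞`.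
[cite: CastellaGrossiLeeSkinner2022, Thm. 4.1.1 proof and Rem. 4.1.4 (κ_∞ := lim←_k κ_k; «generate the same Λ-submodule»)]
[cite: Howard2004HeegnerKolyvagin, §3.3 and Thm. 3.3.7] [cite: PerrinRiou1987BSMF, §3.4 Prop. 10] -/
theorem exists_coherent_pair_envelope_principal_class (hK : IsImaginaryQuadratic K)
    (hH : SatisfiesHeegnerHypothesis (W.conductorNorm ℤ) K) (Dt : ModularParametrizationData W (W.conductorNorm ℤ))
    {β : ℤ} (hβ : (4 * (W.conductorNorm ℤ : ℕ) : ℤ) ∣ β ^ 2 - NumberField.discr K)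
    (jbar : AlgebraicClosure K →+* ℂ) (hord : IsOrdinaryAt W p) (hpN : ¬ p ∣ W.conductorNorm ℤ)
    (κ : ZpExtension K p) {γ : Field.absoluteGaloisGroup K} (hγ : κ.IsTopGenerator γ)
    (hTw1 : ∀ k, ringClassSubgroup K (p ^ (k + 1)) jbar ≤ κ.layerSubgroup k)
    (hcardp : Nat.card (ringClassGalOver (jbar.comp (algebraMap K (AlgebraicClosure K))) p 1) = p - 1)
    (hE : ∀ Q : (W.baseChange K).toAffine.Point, p • Q = 0 → Q = 0)
    (D : (W.baseChange K).LambdaAdicSelmerData κ γ) :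
    ∃ (C : StabilizedHeegnerData (W.conductorNorm ℤ) W K κ jbar) (F : HeegnerFamily (W.conductorNorm ℤ) W K κ jbar)
      (x : ℕ → geomPoints (W.baseChange K)) (A : ℕ → Finset (Field.absoluteGaloisGroup K)),
      C.Dt = Dt ∧ F.Dt = Dt ∧ C.β = β ∧ F.β = β ∧
      (∀ j, complexPoint W jbar (x j) = heegnerPointComplexOfConductor Dt (NumberField.discr K) β (p ^ j)) ∧
      (∀ j, ∀ σ ∈ ringClassSubgroup K (p ^ j) jbar, σ • x j = x j) ∧
      (∀ k, (∀ a ∈ A k, a ∈ κ.layerSubgroup k) ∧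
        ∀ τ ∈ κ.layerSubgroup k, ∃! a, a ∈ A k ∧ a⁻¹ * τ ∈ ringClassSubgroup K (p ^ C.d k) jbar) ∧
      (∀ k, C.u k = ∑ a ∈ A k, a • x (C.d k)) ∧ (∀ k, C.v k = ∑ a ∈ A k, a • x (C.d k - 1)) ∧
      heegnerModule D F ≤ stabilizedHeegnerModule D C ∧
      (∃ g : IwasawaAlgebra p, g ≠ 0 ∧ g • stabilizedHeegnerModule D C ≤ heegnerModule D F) ∧
      ∃ z : D.S, (∀ (k : ℕ) (hk : C.depth < k), D.proj k z ∈ stabilizedClassLayer C k hk) ∧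
        stabilizedHeegnerModule D C = Submodule.span (IwasawaAlgebra p) {z} := by
  have hp : p.Prime := Fact.out
  have hap : ¬ (p : ℤ) ∣ W.frobeniusTrace p := hord.2
  -- the principal system and the two coherent structures on it
  obtain ⟨x, P, hxP⟩ := exists_principalSystem hK hH Dt hβ jbar hp hpN
  have hx : ∀ j, complexPoint W jbar (x j) = heegnerPointComplexOfConductor Dt (NumberField.discr K) β (p ^ j) :=
    fun j ↦ (hxP j).1
  have hP : ∀ j, WeierstrassCurve.Affine.Point.map (W' := W)
      (ringClassField K (jbar.comp (algebraMap K (AlgebraicClosure K))) (p ^ j)).subtype.toRatAlgHom (P j) =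
      heegnerPointComplexOfConductor Dt (NumberField.discr K) β (p ^ j) := fun j ↦ (hxP j).2.1
  have hgeom : ∀ j, IsHeegnerGeomPoint (W.conductorNorm ℤ) W K Dt β (p ^ j) jbar (x j) := fun j ↦ (hxP j).2.2.1
  have hfix : ∀ j, ∀ σ ∈ ringClassSubgroup K (p ^ j) jbar, σ • x j = x j := fun j ↦ (hxP j).2.2.2
  obtain ⟨F, T, R, hFDt, hFβ, -, -, hR, hz⟩ := exists_heegnerFamily_of_system Dt hβ jbar κ hgeom hfix
  obtain ⟨C, Aₜ, hCDt, hCβ, hdle, htwo, hA, hu, hv⟩ :=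
    exists_stabilizedHeegnerData_of_system hK Dt hβ jbar κ hTw1 hcardp hgeom hfix
  -- a Lucas pair
  obtain ⟨A, hA0, hA1, hArec⟩ := exists_int_lucas_seq (W.frobeniusTrace p) p 1 (W.frobeniusTrace p)
  obtain ⟨B, hB0, hB1, hBrec⟩ := exists_int_lucas_seq (W.frobeniusTrace p) p 0 (-1)
  -- shift bookkeeping above the depth
  have hd1 : ∀ j, C.depth ≤ j → 2 ≤ C.d (j + 1) := fun j hj ↦ htwo (j + 1) (by omega)
  have hnot : ∀ j, C.depth ≤ j → ¬ ringClassSubgroup K (p ^ (C.d (j + 1) - 1)) jbar ≤ κ.layerSubgroup (j + 1) :=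
    fun j hj ↦ C.d_min (j + 1) _ (by have := hd1 j hj; omega)
  have hd0 : ∀ j, C.depth < j → 1 ≤ C.d j := fun j hj ↦ le_trans one_le_two (htwo j hj)
  have hd01 : ∀ j, C.depth < j → C.d j ≤ C.d (j + 1) - 1 := by
    intro j hj
    have hpred := ringClassSubgroup_pred_le_layerSubgroup hK jbar κ (hd1 j hj.le) (C.layer_le (j + 1))
      (hnot j hj.le)
    exact not_lt.mp fun h ↦ C.d_min j _ h hpred
  -- the shift law for the jumps `n_j = d(j+1) − 1 − d(j)`
  have hshift : ∀ j, C.depth < j → C.d (j + 1) = C.d j + (C.d (j + 1) - 1 - C.d j) + 1 := by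
    intro j hj
    have h01 := hd01 j hj
    have h1 := hd1 j hj.le
    omega
  -- the point identities (P1′), (P1″), (P2′), (P3) for `(C, F)` with the jumps `n_j = d(j+1) − 1 − d(j)`
  have hv1 : ∀ j, C.depth < j →
      C.v (j + 1) = A (C.d (j + 1) - 1 - C.d j) • C.u j + B (C.d (j + 1) - 1 - C.d j) • C.v j := by
    intro j hj
    have h := sum_transversal_smul_pred_eq_lucas_of_layer_succ hK hH Dt hβ jbar hpN hx hP hfix κ A B hA0 hA1
      hArec hB0 hB1 hBrec (k := j) (d₁ := C.d (j + 1)) (d₀ := C.d j) (hd1 j hj.le) (C.layer_le (j + 1))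
      (hnot j hj.le) (hA (j + 1)).1 (hA (j + 1)).2 (hd0 j hj) (hd01 j hj) (C.layer_le j)
      (hA j).1 (hA j).2
    rw [hv (j + 1), hu j, hv j]
    exact h
  have hvfix : ∀ j, C.depth ≤ j → ∀ σ ∈ κ.layerSubgroup j, σ • C.v (j + 1) = C.v (j + 1) := by
    intro j hj σ hσ
    rw [hv (j + 1)]
    exact smul_sum_transversal_smul_pred_eq_of_layer_succ hK jbar hfix κ (hd1 j hj) (C.layer_le (j + 1))
      (hnot j hj) (hA (j + 1)).1 (hA (j + 1)).2 hσ
  have hnorm : ∀ j, C.depth < j →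
      ∑ i ∈ Finset.range p, (γ ^ (p ^ j * i)) • C.u (j + 1) =
        A (C.d (j + 1) - 1 - C.d j + 1) • C.u j + B (C.d (j + 1) - 1 - C.d j + 1) • C.v j := by
    intro j hj
    have h := sum_range_pow_smul_sum_transversal_smul_eq_lucas hK hH Dt hβ jbar hpN hx hP hfix κ A B hA0 hA1
      hArec hB0 hB1 hBrec hγ (k := j) (d₁ := C.d (j + 1)) (d₀ := C.d j) (hd1 j hj.le) (C.layer_le (j + 1))
      (hA (j + 1)).1 (hA (j + 1)).2 (hd0 j hj) (hd01 j hj) (C.layer_le j) (hA j).1 (hA j).2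
    have heq : C.d (j + 1) - C.d j = C.d (j + 1) - 1 - C.d j + 1 := by
      have h01 := hd01 j hj
      have h1 := hd1 j hj.le
      omega
    rw [hu (j + 1), hu j, hv j, ← heq]
    exact h
  have hz' : ∀ j, C.depth < j → ∃ a b : ℤ, ¬ (p : ℤ) ∣ a ∧ F.z j = a • C.u j + b • C.v j :=
    fun j hj ↦ HeegnerFamily.exists_z_eq_zsmul_u_add_zsmul_v_of_presentation F C hK hH Dt hβ hpN hap hTw1
      hcardp hxP hA hu hv hR hz hj
  -- the `Λ`-adic stabilised class with exact projections, and the cyclicity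
  obtain ⟨z, hzcl⟩ := exists_proj_mem_stabilizedClassLayer_of_coherent D C hord hγ A B hA0 hA1 hArec hB0 hB1
    hBrec (fun j ↦ C.d (j + 1) - 1 - C.d j) hv1 (fun j hj ↦ hvfix j hj.le) hnorm hshift
  have hunit : IsUnit (1 : ℤ_[p]) := isUnit_one
  have hcyc : stabilizedHeegnerModule D C = Submodule.span (IwasawaAlgebra p) {z} :=
    stabilizedHeegnerModule_eq_span_singleton D C hE fun k hk ↦
      ⟨1, hunit, D.proj k z, hzcl k hk, (padicPi_one (W.baseChange K) p (κ.layerSubgroup k) _).symm⟩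
  -- assemble
  refine ⟨C, F, x, Aₜ, hCDt, hFDt, hCβ, hFβ, hx, hfix, hA, hu, hv, ?_, ?_, z, hzcl, hcyc⟩
  · exact heegnerModule_le_stabilizedHeegnerModule_of_coherent D F C hord hγ hE A B hA0 hA1 hArec hB0 hB1 hBrec
      (fun j ↦ C.d (j + 1) - 1 - C.d j) hv1 (fun j hj ↦ hvfix j hj.le) hnorm (fun j hj ↦ by
        obtain ⟨a, b, -, h⟩ := hz' j hj
        exact ⟨a, b, h⟩)
  · exact exists_ne_zero_smul_stabilizedHeegnerModule_le_heegnerModule_of_coherent D F C hγ hz'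
      (fun j hj ↦ ⟨_, _, hv1 j hj⟩) (hvfix C.depth le_rfl)

/-- **The coherent pair with its `Λ`-adic stabilised class** (the principal system forgotten): under the engine's
hypotheses, `∃ C F` on `(Dt, β)` with `ℋ_∞(F) ≤ Λκ_∞(C)`, `g • Λκ_∞(C) ≤ ℋ_∞(F)` (`g ≠ 0`) and `∃ κ_∞ ∈ 𝔖` with
`proj_k κ_∞ ∈ stabilizedClassLayer C k` for all `k > δ` and `Λκ_∞(C) = Λ ∙ κ_∞` — the shape of the L∃ letter's
`∃ C F` block plus the generator. [cite: CastellaGrossiLeeSkinner2022, Rem. 4.1.4 (arXiv:2008.02571v2 TeX L2278–2294)]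
[cite: Howard2004HeegnerKolyvagin, Thm. 3.3.7] -/
theorem exists_coherent_pair_envelope_class (hK : IsImaginaryQuadratic K)
    (hH : SatisfiesHeegnerHypothesis (W.conductorNorm ℤ) K) (Dt : ModularParametrizationData W (W.conductorNorm ℤ))
    {β : ℤ} (hβ : (4 * (W.conductorNorm ℤ : ℕ) : ℤ) ∣ β ^ 2 - NumberField.discr K)
    (jbar : AlgebraicClosure K →+* ℂ) (hord : IsOrdinaryAt W p) (hpN : ¬ p ∣ W.conductorNorm ℤ)
    (κ : ZpExtension K p) {γ : Field.absoluteGaloisGroup K} (hγ : κ.IsTopGenerator γ)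
    (hTw1 : ∀ k, ringClassSubgroup K (p ^ (k + 1)) jbar ≤ κ.layerSubgroup k)
    (hcardp : Nat.card (ringClassGalOver (jbar.comp (algebraMap K (AlgebraicClosure K))) p 1) = p - 1)
    (hE : ∀ Q : (W.baseChange K).toAffine.Point, p • Q = 0 → Q = 0)
    (D : (W.baseChange K).LambdaAdicSelmerData κ γ) :
    ∃ (C : StabilizedHeegnerData (W.conductorNorm ℤ) W K κ jbar) (F : HeegnerFamily (W.conductorNorm ℤ) W K κ jbar),
      C.Dt = Dt ∧ F.Dt = Dt ∧ C.β = β ∧ F.β = β ∧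
      heegnerModule D F ≤ stabilizedHeegnerModule D C ∧
      (∃ g : IwasawaAlgebra p, g ≠ 0 ∧ g • stabilizedHeegnerModule D C ≤ heegnerModule D F) ∧
      ∃ z : D.S, (∀ (k : ℕ) (hk : C.depth < k), D.proj k z ∈ stabilizedClassLayer C k hk) ∧
        stabilizedHeegnerModule D C = Submodule.span (IwasawaAlgebra p) {z} := by
  obtain ⟨C, F, -, -, hCDt, hFDt, hCβ, hFβ, -, -, -, -, -, hfwd, hrev, hcl⟩ :=
    exists_coherent_pair_envelope_principal_class hK hH Dt hβ jbar hord hpN κ hγ hTw1 hcardp hE D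
  exact ⟨C, F, hCDt, hFDt, hCβ, hFβ, hfwd, hrev, hcl⟩

end Envelope

end Literature.NumberTheory.EllipticCurves

end
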